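import Mathlib.GroupTheory.PresentedGroup
import Mathlib.Algebra.Group.Subgroup.ZPowers.Basic
import HarnessLib

/-!
# The fundamental group of a punctured surface (surface group with punctures)

The group `Γ_{g,r} = ⟨a₁, b₁, …, a_g, b_g, c₁, …, c_r ∣ [a₁,b₁]⋯[a_g,b_g]·c₁⋯c_r = 1⟩`, the
(topological) fundamental group of a compact orientable surface of genus `g` with `r` points removed
(equivalently, of a hyperbolic Riemann surface of finite type `(g, r)` when `2g − 2 + r > 0`), as a
`PresentedGroup`; the `c_j` generate the *inertia (cuspidal) subgroups*.  For `r = 0` this is the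
closed surface group (cf. the tree's `Literature.Topology.FourManifolds.SurfaceGroup`, which we do
not import to keep this file Mathlib-only); for `r > 0` the group is free of rank `2g + r − 1`
(not proved here).  Used by [SemiAnbd] Example 2.10 (semi-graphs of anabelioids of stable curves)
[cite: MochizukiSemiAnbd2006, Ex. 2.10 p.31].
-/

namespace Literature.GroupTheory.CombinatorialGroupTheory

/-- Generators of `Γ_{g,r}`: `inl (i, false) = aᵢ`, `inl (i, true) = bᵢ`, `inr j = c_j`. [folklore] -/
abbrev puncturedSurfaceGen (g r : ℕ) : Type := (Fin g × Bool) ⊕ Fin r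

namespace PuncturedSurfaceGroup

variable {g r : ℕ}

/-- The generator `aᵢ` in the free group. [folklore] -/
def genA (i : Fin g) : FreeGroup (puncturedSurfaceGen g r) := FreeGroup.of (Sum.inl (i, false))

/-- The generator `bᵢ` in the free group. [folklore] -/
def genB (i : Fin g) : FreeGroup (puncturedSurfaceGen g r) := FreeGroup.of (Sum.inl (i, true))

/-- The generator `c_j` (loop around the `j`-th puncture) in the free group. [folklore] -/
def genC (j : Fin r) : FreeGroup (puncturedSurfaceGen g r) := FreeGroup.of (Sum.inr j)

variable (g r) in
/-- The relator `[a₁,b₁]⋯[a_g,b_g]·c₁⋯c_r`. [folklore] -/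
def relator : FreeGroup (puncturedSurfaceGen g r) :=
  ((List.finRange g).map fun i =>
      genA (r := r) i * genB (r := r) i * (genA (r := r) i)⁻¹ * (genB (r := r) i)⁻¹).prod *
    ((List.finRange r).map fun j => genC (g := g) j).prod

end PuncturedSurfaceGroup

/-- The punctured surface group
`Γ_{g,r} = ⟨a₁, b₁, …, a_g, b_g, c₁, …, c_r ∣ [a₁,b₁]⋯[a_g,b_g]·c₁⋯c_r⟩`, the fundamental group of a
genus-`g` surface with `r` punctures (a hyperbolic Riemann surface of type `(g, r)` when
`2g − 2 + r > 0`, [SemiAnbd] Example 2.10). [cite: MochizukiSemiAnbd2006, Ex. 2.10 p.31] -/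
abbrev PuncturedSurfaceGroup (g r : ℕ) : Type :=
  PresentedGroup ({PuncturedSurfaceGroup.relator g r} : Set (FreeGroup (puncturedSurfaceGen g r)))

namespace PuncturedSurfaceGroup

variable {g r : ℕ}

/-- The image of `aᵢ` in `Γ_{g,r}`. [folklore] -/
def a (i : Fin g) : PuncturedSurfaceGroup g r := PresentedGroup.of (Sum.inl (i, false))

/-- The image of `bᵢ` in `Γ_{g,r}`. [folklore] -/
def b (i : Fin g) : PuncturedSurfaceGroup g r := PresentedGroup.of (Sum.inl (i, true))

/-- The image of `c_j` in `Γ_{g,r}`: a generator of the inertia subgroup at the `j`-th puncture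
(cusp). [folklore] -/
def c (j : Fin r) : PuncturedSurfaceGroup g r := PresentedGroup.of (Sum.inr j)

/-- The *inertia subgroup* of the `j`-th cusp: the cyclic subgroup generated by `c_j` (well defined
up to conjugation as a subgroup of `π₁`; [SemiAnbd] Example 2.10 "the inertia group of one of the
cusps"). [cite: MochizukiSemiAnbd2006, Ex. 2.10 p.31] -/
def cuspInertia (j : Fin r) : Subgroup (PuncturedSurfaceGroup g r) := Subgroup.zpowers (c j)

/-- The type `(g, r)` is *hyperbolic*: `2g − 2 + r > 0`, i.e. `2 < 2g + r`
([SemiAnbd] §0 "Curves", p. 9). [cite: MochizukiSemiAnbd2006, §0 p.9] -/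
def IsHyperbolicType (g r : ℕ) : Prop := 2 < 2 * g + r

end PuncturedSurfaceGroup

end Literature.GroupTheory.CombinatorialGroupTheory
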